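import Summits.AtomisticToContinuum.Crystallization.Theorems.PerronTransitivityNoFractionalGainHeartHcpCase

/-!
# Heart of line `merge-perron`, crux `PerronTransitivity.NoFractionalGain` (stmt-AtomisticToContinuum-15098):
# finite pieces of a sub-bound environment (the one-centre regime of the heart)

The heart stub `stub_perronWeights` asks for positive `Λ_hcp`-superharmonic site weights for the binding
kernel `[−V_LJ(dist xᵢ xⱼ)]` of every `2^{-1/6}`-separated finite configuration.  This file isolates the
regime in which the CONSTANT weights `w ≡ 1` already work: `x` is a finite piece of a separated environment
`X ⊆ ℝ³` (finite or infinite: a cluster, a periodic crystal, any uniformly discrete set with summable site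
sums) NONE of whose sites is bound better than `Λ`, i.e. `Σ'_{q ∈ X, q ≠ p} V_LJ(dist p q) ≥ −Λ` at every
`p ∈ X`.  Then every finite site sum inside the piece is `≥ −Λ` (it omits only non-positive terms), so the
row sums of the binding kernel are `≤ Λ` and the one-centre certificate applies.  Numerically (card
no-fractional-gain-perron-transitivity, kit j002036 / j023343) this covers every Frank–Kasper phase (best
site `0.986 Λ_hcp`), bcc, and all Barlow stackings at near-optimal spacing; what it does NOT cover —
environments with super-bound sites (compressed icosahedral centres `+2.3 %`, Z16 sites) — is exactly the
open content of the heart, where genuinely non-constant weights are needed.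
-/

noncomputable section

namespace Summit.AtomisticToContinuum.Crystallization.Theorems.PerronTransitivity.NoFractionalGain

open Literature.MathematicalPhysics.StatisticalMechanics
open scoped BigOperators

/-- **Finite site sums inside a piece of a separated environment dominate the full site sums.**  If
`X ⊆ ℝ³` has pairwise `dist⁶ ≥ 1/2` (every pair attracts), the site sum of `X` at `x i` is summable, and
`x` is an injective finite family of points of `X`, then
`Σ'_{q ∈ X, q ≠ xᵢ} V_LJ(dist xᵢ q) ≤ Σ_{j ≠ i} V_LJ(dist xᵢ xⱼ)`. [folklore] -/
theorem tsum_site_le_finite_siteSum {X : Set (EuclideanSpace ℝ (Fin 3))}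
    (hsepX : ∀ p ∈ X, ∀ q ∈ X, p ≠ q → (1 : ℝ) / 2 ≤ dist p q ^ 6)
    {N : ℕ} (x : Fin N → EuclideanSpace ℝ (Fin 3)) (hx : Function.Injective x)
    (hmem : ∀ i, x i ∈ X) (i : Fin N)
    (hsum : Summable fun q : {q : EuclideanSpace ℝ (Fin 3) // q ∈ X ∧ q ≠ x i} =>
      lennardJones (dist (x i) q.1)) :
    ∑' q : {q : EuclideanSpace ℝ (Fin 3) // q ∈ X ∧ q ≠ x i}, lennardJones (dist (x i) q.1) ≤
      ∑ j ∈ Finset.univ.erase i, lennardJones (dist (x i) (x j)) := by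
  classical
  have hnonpos : ∀ q : {q : EuclideanSpace ℝ (Fin 3) // q ∈ X ∧ q ≠ x i},
      lennardJones (dist (x i) q.1) ≤ 0 := fun q =>
    lennardJones_nonpos_of_half_le_pow_six (hsepX _ (hmem i) _ q.2.1 (Ne.symm q.2.2))
  let φ : {j // j ∈ Finset.univ.erase i} → {q : EuclideanSpace ℝ (Fin 3) // q ∈ X ∧ q ≠ x i} :=
    fun j => ⟨x j.1, hmem j.1, hx.ne (Finset.ne_of_mem_erase j.2)⟩
  have hφ : Function.Injective φ := by
    intro j j' hjj'
    have : x j.1 = x j'.1 := congrArg Subtype.val hjj'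
    exact Subtype.ext (hx this)
  set S : Finset {q : EuclideanSpace ℝ (Fin 3) // q ∈ X ∧ q ≠ x i} := Finset.univ.image φ with hS
  have hfin : ∑ j ∈ Finset.univ.erase i, lennardJones (dist (x i) (x j)) =
      ∑ q ∈ S, lennardJones (dist (x i) q.1) := by
    rw [hS, Finset.sum_image fun j _ j' _ h => hφ h, ← Finset.sum_attach (Finset.univ.erase i)]
    rfl
  have hneg : ∑ q ∈ S, -lennardJones (dist (x i) q.1) ≤
      -∑' q : {q : EuclideanSpace ℝ (Fin 3) // q ∈ X ∧ q ≠ x i}, lennardJones (dist (x i) q.1) :=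
    sum_le_hasSum S (fun q _ => by linarith [hnonpos q]) hsum.hasSum.neg
  rw [Finset.sum_neg_distrib] at hneg
  rw [hfin]
  linarith

/-- **Stub `stub_perronWeightsSubBoundCase` (registered sub-goal of the heart, stmt-AtomisticToContinuum-15098):
finite pieces of a `Λ`-sub-bound separated environment carry `Λ`-superharmonic constant weights.**  If
`X ⊆ ℝ³` has pairwise `dist⁶ ≥ 1/2`, summable Lennard-Jones site sums, and NO site bound better than `Λ`
(`−Λ ≤ Σ'_{q ∈ X, q ≠ p} V_LJ(dist p q)` for all `p ∈ X`), then for every injective finite family `x` of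
points of `X` the weights `w ≡ 1` satisfy `Σ_{j≠i} [−V_LJ(dist xᵢ xⱼ)]·wⱼ ≤ Λ·wᵢ` at every site (the
one-centre regime of `stub_perronWeights`; with `X` an hcp crystal and `Λ = −2e_LJ(hcp)` it is
`stub_perronWeightsHcpCase`). [folklore] -/
theorem stub_perronWeightsSubBoundCase : ∀ (Λ : ℝ) (X : Set (EuclideanSpace ℝ (Fin 3))),
    (∀ p ∈ X, ∀ q ∈ X, p ≠ q → (1 : ℝ) / 2 ≤ dist p q ^ 6) →
    (∀ p ∈ X, Summable fun q : {q : EuclideanSpace ℝ (Fin 3) // q ∈ X ∧ q ≠ p} =>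
      lennardJones (dist p q.1)) →
    (∀ p ∈ X, -Λ ≤ ∑' q : {q : EuclideanSpace ℝ (Fin 3) // q ∈ X ∧ q ≠ p}, lennardJones (dist p q.1)) →
    ∀ (N : ℕ) (x : Fin N → EuclideanSpace ℝ (Fin 3)), Function.Injective x → (∀ i, x i ∈ X) →
      ∃ w : Fin N → ℝ, (∀ i, 0 < w i) ∧
        ∀ i, ∑ j ∈ Finset.univ.erase i, -lennardJones (dist (x i) (x j)) * w j ≤ Λ * w i := by
  intro Λ X hsepX hsumX hsite N x hx hmem
  refine ⟨fun _ => 1, fun _ => one_pos, fun i => ?_⟩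
  have h1 := tsum_site_le_finite_siteSum hsepX x hx hmem i (hsumX _ (hmem i))
  have h2 := hsite _ (hmem i)
  have hre : ∑ j ∈ Finset.univ.erase i, -lennardJones (dist (x i) (x j)) * (1 : ℝ) =
      -∑ j ∈ Finset.univ.erase i, lennardJones (dist (x i) (x j)) := by
    rw [← Finset.sum_neg_distrib]
    exact Finset.sum_congr rfl fun j _ => by ring
  rw [hre]
  linarith

/-- Consequently the norm bound of the heart holds with constant `Λ` on weighted finite pieces of a
`Λ`-sub-bound separated environment: `−Λ·Σcᵢ² ≤ Σ_{i≠j} cᵢcⱼV_LJ(dist xᵢ xⱼ)` for all real `c`. [folklore] -/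
theorem perronKepler_on_subBound_pieces (Λ : ℝ) {X : Set (EuclideanSpace ℝ (Fin 3))}
    (hsepX : ∀ p ∈ X, ∀ q ∈ X, p ≠ q → (1 : ℝ) / 2 ≤ dist p q ^ 6)
    (hsumX : ∀ p ∈ X, Summable fun q : {q : EuclideanSpace ℝ (Fin 3) // q ∈ X ∧ q ≠ p} =>
      lennardJones (dist p q.1))
    (hsite : ∀ p ∈ X, -Λ ≤ ∑' q : {q : EuclideanSpace ℝ (Fin 3) // q ∈ X ∧ q ≠ p},
      lennardJones (dist p q.1))
    {N : ℕ} (x : Fin N → EuclideanSpace ℝ (Fin 3)) (hx : Function.Injective x) (hmem : ∀ i, x i ∈ X)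
    (c : Fin N → ℝ) :
    -Λ * ∑ i, c i ^ 2 ≤ ∑ i, ∑ j ∈ Finset.univ.erase i, c i * c j * lennardJones (dist (x i) (x j)) := by
  have hattr : ∀ i j, i ≠ j → lennardJones (dist (x i) (x j)) ≤ 0 := fun i j hij =>
    lennardJones_nonpos_of_half_le_pow_six (hsepX _ (hmem i) _ (hmem j) (hx.ne hij))
  have hrow : ∀ i, -∑ j ∈ Finset.univ.erase i, lennardJones (dist (x i) (x j)) ≤ Λ := fun i => by
    have h1 := tsum_site_le_finite_siteSum hsepX x hx hmem i (hsumX _ (hmem i))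
    have h2 := hsite _ (hmem i)
    linarith
  exact lj_quadForm_ge_of_rowSum_le x Λ hattr hrow c

/-- **A finite cluster with no super-bound site** (the case `X = range x`): if a `2^{-1/6}`-separated finite
configuration has every finite site sum `≥ −Λ`, its binding form satisfies `−Λ·Σcᵢ² ≤ Σ_{i≠j} cᵢcⱼV_ij` for
all real `c` — so every counterexample to the heart must contain a site bound better than `Λ_hcp`. [folklore] -/
theorem perronKepler_of_noSuperBoundSite (Λ : ℝ) {N : ℕ} (x : Fin N → EuclideanSpace ℝ (Fin 3))
    (hsep : ∀ i j, i ≠ j → (1 : ℝ) / 2 ≤ dist (x i) (x j) ^ 6)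
    (hsite : ∀ i, -Λ ≤ ∑ j ∈ Finset.univ.erase i, lennardJones (dist (x i) (x j))) (c : Fin N → ℝ) :
    -Λ * ∑ i, c i ^ 2 ≤ ∑ i, ∑ j ∈ Finset.univ.erase i, c i * c j * lennardJones (dist (x i) (x j)) :=
  lj_quadForm_ge_of_rowSum_le x Λ
    (fun i j hij => lennardJones_nonpos_of_half_le_pow_six (hsep i j hij))
    (fun i => by linarith [hsite i]) c

end Summit.AtomisticToContinuum.Crystallization.Theorems.PerronTransitivity.NoFractionalGain

end
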